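import Mathlib
import Literature.Computability.AlgebraicComplexity.GenericTorusGrading
import Summits.ValiantsHypothesis.ValiantsHypothesis.Theorems.FreeSubtorusConfusionCoveringGradedForm
import Summits.ValiantsHypothesis.ValiantsHypothesis.Theorems.FreeSubtorusConfusionCoveringPathWeights

/-!
# Line `row_torus` of the crux `OrbitDimensionBound` (stmt-ValiantsHypothesis-16133, route FreeSubtorus):
# the stub `stub_rowGradedForm` — `d`-graded bipartite form (registered signature, `IsRowGraded` unfolded)

Registered stub 2 of the ACTIVE skeleton `Cruxes/OrbitDimensionBound/Lines/row_torus.lean` (rung `RowShadow`):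
for ANY affine matrix `B` and any pair `(g, h) ∈ GL_m²` with `g B₀ = B₀ h` and `g B_{kl} = d_k B_{kl} h`, bases adapted to
the generalised eigenspaces of `h` (columns, grades `α`) and `g` (rows, grades `β`) put `B` in `d`-GRADED BIPARTITE FORM:
entry `(i,j)` = constant supported on `β_i = α_j` + linear forms whose `x_{kl}`-coefficient is supported on
`β_i = d_k α_j`.  This is the special case `w (k,l) = d_k` of `exists_gradedForm`
(`Theorems/FreeSubtorusConfusionCoveringGradedForm.lean`), with the grades promoted to units (`g, h` invertible, so
their generalised eigenvalues are non-zero).  The Cruxes-local predicate `IsRowGraded` is unfolded verbatim; the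
skeleton closes its stub by `exact` (modulo `IsRowGraded`'s `Iff.rfl`). [cite: LandsbergRessayre2017, §6]
-/

open Matrix MvPolynomial Finset Module.End
open Literature.Computability.AlgebraicComplexity LRPencil

-- the mandated summit-side namespace repeats a component by design (single-problem summit)
set_option linter.dupNamespace false

namespace Summit.ValiantsHypothesis.ValiantsHypothesis.Theorems.FreeSubtorusRowTorus

noncomputable section

/-- Generalised eigenvalues produced by `exists_adapted_basis` for an INVERTIBLE matrix are non-zero: a weight that
occurs (`#{j | α j = α j₀} ≥ 1 = dim E(α j₀) ≥ 1`) of an injective endomorphism is `≠ 0`. [folklore] -/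
theorem weight_ne_zero_of_count {m : ℕ} (h : GL (Fin m) ℂ) (α : Fin m → ℂ)
    (hα : ∀ μ, (univ.filter fun j => α j = μ).card =
      Module.finrank ℂ (Module.End.maxGenEigenspace (Matrix.toLin' (h : Matrix (Fin m) (Fin m) ℂ)) μ))
    (j : Fin m) : α j ≠ 0 := by
  classical
  intro h0
  have hinj : Function.Injective (Matrix.toLin' (h : Matrix (Fin m) (Fin m) ℂ)) := by
    intro x y hxy
    rw [Matrix.toLin'_apply, Matrix.toLin'_apply] at hxy
    exact (Matrix.mulVec_injective_iff_isUnit.2 (Units.isUnit h)) hxy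
  have h1 : 1 ≤ (univ.filter fun j' => α j' = α j).card :=
    Finset.one_le_card.2 ⟨j, mem_filter.2 ⟨mem_univ _, rfl⟩⟩
  rw [hα, h0, maxGenEigenspace_zero_eq_bot_of_injective _ hinj, finrank_bot] at h1
  exact Nat.not_succ_le_zero 0 h1

/-- **Registered stub `stub_rowGradedForm` (line `row_torus`), with `IsRowGraded` unfolded.**  An affine matrix `B`
admitting `(g, h) ∈ GL_m²` with `g B₀ = B₀ h` and `g B_{kl} = d_k B_{kl} h` is `GL_m × GL_m`-equivalent to a `d`-graded
bipartite matrix: there are `P, Q ∈ GL_m` and grades `α, β : [m] → ℂˣ` such that every entry of `P B Q` is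
`C a₀ + Σ_p a_p x_p` with `a₀ ≠ 0 ⇒ β_i = α_j` and `a_p ≠ 0 ⇒ β_i = d_{p.1} α_j`. [cite: LandsbergRessayre2017, §6] -/
theorem stub_rowGradedForm :
    ∀ (n m : ℕ) (B : Matrix (Fin m) (Fin m) (MvPolynomial (Fin n × Fin n) ℂ)) (d : Fin n → ℂˣ)
    (g h : GL (Fin m) ℂ),
    (∀ i j, (B i j).totalDegree ≤ 1) →
    (g : Matrix (Fin m) (Fin m) ℂ) * constPart B = constPart B * (h : Matrix (Fin m) (Fin m) ℂ) →
    (∀ p : Fin n × Fin n, (g : Matrix (Fin m) (Fin m) ℂ) * coeffMat B p =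
        (d p.1 : ℂ) • (coeffMat B p * (h : Matrix (Fin m) (Fin m) ℂ))) →
    ∃ (P Q : GL (Fin m) ℂ) (α β : Fin m → ℂˣ),
      ∀ i j, ∃ (a₀ : ℂ) (a : Fin n × Fin n → ℂ),
        ((P : Matrix (Fin m) (Fin m) ℂ).map C * B * (Q : Matrix (Fin m) (Fin m) ℂ).map C :
          Matrix (Fin m) (Fin m) (MvPolynomial (Fin n × Fin n) ℂ)) i j = C a₀ + ∑ p, a p • X p ∧
        (a₀ ≠ 0 → β i = α j) ∧
        (∀ p, a p ≠ 0 → β i = d p.1 * α j) := by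
  intro n m B d g h haff hgΛ hgA
  classical
  obtain ⟨P, Q, α', β', hconst, hcoef, hβ', hα'⟩ :=
    FreeSubtorusConfusionCovering.exists_gradedForm B (fun p : Fin n × Fin n => (d p.1 : ℂ))
      (g : Matrix (Fin m) (Fin m) ℂ) h hgΛ hgA
  have hα0 : ∀ j, α' j ≠ 0 := weight_ne_zero_of_count h α' hα'
  have hβ0 : ∀ i, β' i ≠ 0 := weight_ne_zero_of_count g β' hβ'
  set B' := (P : Matrix (Fin m) (Fin m) ℂ).map C * B * (Q : Matrix (Fin m) (Fin m) ℂ).map C with hB'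
  have haff' : ∀ i j, (B' i j).totalDegree ≤ 1 :=
    FreeSubtorusConfusionCovering.totalDegree_C_mul_mul_C_le_one _ _ B haff
  refine ⟨P, Q, fun j => Units.mk0 (α' j) (hα0 j), fun i => Units.mk0 (β' i) (hβ0 i), fun i j => ?_⟩
  refine ⟨coeff 0 (B' i j), fun p => coeff (Finsupp.single p 1) (B' i j), ?_, fun h0 => ?_, fun p hp => ?_⟩
  · show B' i j = _
    conv_lhs => rw [eq_affine_of_totalDegree_le_one (B' i j) (haff' i j)]
    simp only [smul_eq_C_mul]
  · apply Units.val_injective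
    simp only [Units.val_mk0]
    apply hconst i j
    rwa [constPart_apply, constantCoeff_eq]
  · apply Units.val_injective
    simp only [Units.val_mul, Units.val_mk0]
    apply hcoef p i j
    rwa [coeffMat_apply]

end

end Summit.ValiantsHypothesis.ValiantsHypothesis.Theorems.FreeSubtorusRowTorus
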